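import Mathlib
import HarnessLib
import Summits.CriticalPhenomena.SAWScalingLimit.Theorems.SAWRenewalTightnessConfinementPositivityRademacherTube

/-!
# Stub `stub_rademacherAntiTube` (R2) of crux `ConfinementPositivity` (stmt-CriticalPhenomena-17587),
# line `Sketch` (card sign-universality): the universal Rademacher ANTI-tube lemma

A distribution-free small-ball UPPER bound for `±`-walks with prescribed steps.  Let
`h : Fin n → ℕ` be step sizes with `hᵢ ≤ r` (`r ≥ 1`) and total variance `∑ hᵢ² ≥ 5 K r²`.  Among
the `2ⁿ` sign patterns `σ : Fin n → Bool`, those keeping EVERY partial sum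
`S_k(σ) = ∑_{i<k} ±hᵢ` (`k = 0, …, n`) in the tube `[-r, r]` number at most `2 · 2ⁿ / 2^K`:

`stub_rademacherAntiTube : ∀ n r K h, 1 ≤ r → (∀ i, hᵢ ≤ r) → 5 K r² ≤ ∑ hᵢ² →
  2^K · #{σ | ∀ k ≤ n, |S_k(σ)| ≤ r} ≤ 2 · 2ⁿ`.

Every `5 r²` of accumulated variance halves the number of surviving sign patterns (up to a factor `2`).
This is hypothesis `hR2` of the glue `ConfinementPositivity_of` of the lead skeleton
(`Cruxes/ConfinementPositivity/Lines/Sketch.lean`); the statement inlines `signedPartialSum`.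

## Proof (cosine SUPER-solution / principal-eigenfunction comparison)

Put `b = π/(4r)` and, for a start `y : ℤ`, let `N(m, g, y)` be the number of sign patterns of the
steps `g : Fin m → ℕ` keeping `y + S_k` in `[-r, r]` for all `k ≤ m`.  Peeling the first step gives
the recursion `N(m+1, g, y) = [|y| ≤ r] · (N(m, g', y + g₀) + N(m, g', y - g₀))`
(`rademacherTube_sum_succ` of the R1 module, via `Fin.consEquiv`).  Since `cos(b(y+g₀)) + cos(b(y-g₀)) =
2 cos(b y) cos(b g₀)`, `cos(b gᵢ) ≥ 0` (`b gᵢ ≤ π/4`), `cos(b y) ≥ 0` for `|y| ≤ 2r` and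
`2 cos(b y) ≥ 1` for `|y| ≤ r`, induction on `m` gives the CLAIM (`rademacherAntiTube_cos_claim`)

`N(m, g, y) ≤ 2^m · 2 cos(b y) ∏ᵢ cos(b gᵢ)` whenever `|y| ≤ 2r`.

At `y = 0`: `#tube ≤ 2 · 2ⁿ ∏ cos(b hᵢ) ≤ 2 · 2ⁿ exp(-(b²/4) ∑ hᵢ²) ≤ 2 · 2ⁿ exp(-(5π²/64) K)
≤ 2 · 2ⁿ 2^{-K}`, using `cos x ≤ 1 - x²/2 + (5/96) x⁴ ≤ 1 - x²/4 ≤ exp(-x²/4)` on `[0, 1]`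
(`rademacherAntiTube_cos_le_exp`, from `Real.cos_bound`), `π > 3` and `log 2 < 45/64`.

Pure finite combinatorics and elementary real analysis over Mathlib (`Real.cos_bound`,
`Real.add_one_le_exp`, `Real.log_two_lt_d9`, `Real.pi_gt_three`, `Fin.consEquiv`, `Finset.sum_boole`);
folklore (the discrete analogue of the Dirichlet principal eigenfunction of an interval).  Nothing
about self-avoiding walks is used.  No `def`s: the counting expression is inlined in every statement.
The combinatorial recursion (`rademacherTube_sum_succ`) is imported from the landed lower-bound twin
`SAWRenewalTightnessConfinementPositivityRademacherTube.lean` (R1).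
-/

noncomputable section
open scoped BigOperators
open Classical

namespace Summit.CriticalPhenomena.SAWScalingLimit.Theorems

/-- The step angle `π g / (4 r)` lies in `[0, π/4]` when `g ≤ r` (`r ≥ 1`). -/
theorem rademacherAntiTube_step_angle (r g : ℕ) (hr : 1 ≤ r) (hg : g ≤ r) :
    0 ≤ Real.pi / (4 * r) * g ∧ Real.pi / (4 * r) * g ≤ Real.pi / 4 := by
  have hr' : (0 : ℝ) < r := by exact_mod_cast hr
  have hg' : (g : ℝ) ≤ r := by exact_mod_cast hg
  refine ⟨by positivity, ?_⟩
  rw [div_mul_eq_mul_div, div_le_div_iff₀ (by positivity) (by norm_num)]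
  nlinarith [Real.pi_pos]

/-- Each step factor `cos (π g / (4 r))` is nonnegative when `g ≤ r` (`r ≥ 1`). -/
theorem rademacherAntiTube_cos_step_nonneg (r g : ℕ) (hr : 1 ≤ r) (hg : g ≤ r) :
    0 ≤ Real.cos (Real.pi / (4 * r) * g) := by
  obtain ⟨h0, h1⟩ := rademacherAntiTube_step_angle r g hr hg
  exact Real.cos_nonneg_of_neg_pi_div_two_le_of_le (by linarith [Real.pi_pos])
    (by linarith [Real.pi_pos])

/-- The start factor `cos (π y / (4 r))` is nonnegative whenever `|y| ≤ 2 r` (angle at most `π/2`). -/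
theorem rademacherAntiTube_cos_start_nonneg (r : ℕ) (y : ℤ) (hr : 1 ≤ r)
    (hy : |y| ≤ 2 * (r : ℤ)) : 0 ≤ Real.cos (Real.pi / (4 * r) * y) := by
  have hr' : (0 : ℝ) < r := by exact_mod_cast hr
  have hy' : |(y : ℝ)| ≤ 2 * r := by rw [← Int.cast_abs]; exact_mod_cast hy
  rw [← Real.cos_abs, abs_mul, abs_of_pos (by positivity : 0 < Real.pi / (4 * r))]
  apply Real.cos_nonneg_of_neg_pi_div_two_le_of_le
  · have : 0 ≤ Real.pi / (4 * r) * |(y : ℝ)| := by positivity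
    linarith [Real.pi_pos]
  · rw [div_mul_eq_mul_div, div_le_div_iff₀ (by positivity) (by norm_num)]
    nlinarith [mul_le_mul_of_nonneg_left hy' Real.pi_pos.le]

/-- Inside the tube (`|y| ≤ r`) the start factor is large: `1 ≤ 2 cos (π y / (4 r))`, since the angle is
at most `π/4 ≤ 1` and `cos x ≥ 1 - x²/2`. -/
theorem rademacherAntiTube_one_le_two_cos_start (r : ℕ) (y : ℤ) (hr : 1 ≤ r)
    (hy : |y| ≤ (r : ℤ)) : 1 ≤ 2 * Real.cos (Real.pi / (4 * r) * y) := by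
  have hr' : (0 : ℝ) < r := by exact_mod_cast hr
  have hy' : |(y : ℝ)| ≤ r := by rw [← Int.cast_abs]; exact_mod_cast hy
  have habs : |Real.pi / (4 * r) * y| ≤ 1 := by
    rw [abs_mul, abs_of_pos (by positivity : 0 < Real.pi / (4 * r)), div_mul_eq_mul_div,
      div_le_one (by positivity)]
    exact mul_le_mul Real.pi_le_four hy' (abs_nonneg _) (by norm_num)
  have hx2 : (Real.pi / (4 * r) * y) ^ 2 ≤ 1 := (sq_le_one_iff_abs_le_one _).mpr habs
  have hcos := Real.one_sub_sq_div_two_le_cos (x := Real.pi / (4 * r) * y)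
  linarith

/-- The right-hand side `2^m · 2 cos(π y/(4r)) ∏ cos(π gᵢ/(4r))` of the cosine claim is nonnegative
whenever `|y| ≤ 2r` and all `gᵢ ≤ r`. -/
theorem rademacherAntiTube_rhs_nonneg (r m : ℕ) (g : Fin m → ℕ) (y : ℤ) (hr : 1 ≤ r)
    (hg : ∀ i, g i ≤ r) (hy : |y| ≤ 2 * (r : ℤ)) :
    0 ≤ (2 : ℝ) ^ m * (2 * Real.cos (Real.pi / (4 * r) * y)) *
        ∏ i : Fin m, Real.cos (Real.pi / (4 * r) * g i) := by
  have hc := rademacherAntiTube_cos_start_nonneg r y hr hy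
  have hp : 0 ≤ ∏ i : Fin m, Real.cos (Real.pi / (4 * r) * g i) :=
    Finset.prod_nonneg fun i _ => rademacherAntiTube_cos_step_nonneg r (g i) hr (hg i)
  exact mul_nonneg (mul_nonneg (pow_nonneg zero_le_two _) (mul_nonneg zero_le_two hc)) hp

/-- **Cosine super-solution claim.**  For steps `gᵢ ≤ r` and a start `y` with `|y| ≤ 2r`, the number
of sign patterns keeping `y + S_k` in `[-r, r]` for all `k ≤ m` is at most
`2^m · 2 cos(π y/(4r)) ∏ᵢ cos(π gᵢ/(4r))` (induction on `m`, peeling the first step,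
`cos (p+q) + cos (p-q) = 2 cos p cos q`). -/
theorem rademacherAntiTube_cos_claim (r : ℕ) (hr : 1 ≤ r) (m : ℕ) :
    ∀ (g : Fin m → ℕ) (y : ℤ), (∀ i, g i ≤ r) → |y| ≤ 2 * (r : ℤ) →
      (∑ σ : Fin m → Bool, if (∀ k ≤ m, |y + ∑ i : Fin m, (if (i : ℕ) < k then
          (if σ i then (g i : ℤ) else -(g i : ℤ)) else 0)| ≤ (r : ℤ)) then (1 : ℝ) else 0) ≤
        (2 : ℝ) ^ m * (2 * Real.cos (Real.pi / (4 * r) * y)) *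
          ∏ i : Fin m, Real.cos (Real.pi / (4 * r) * g i) := by
  induction m with
  | zero =>
    intro g y hg hy
    by_cases hyr : |y| ≤ (r : ℤ)
    · calc _ = (1 : ℝ) := by simp [hyr]
        _ ≤ 2 * Real.cos (Real.pi / (4 * r) * y) :=
          rademacherAntiTube_one_le_two_cos_start r y hr hyr
        _ = _ := by simp
    · refine le_trans (le_of_eq (Finset.sum_eq_zero fun σ _ => if_neg fun hall => hyr ?_))
        (rademacherAntiTube_rhs_nonneg r 0 g y hr hg hy)
      simpa using hall 0 (Nat.zero_le _)
  | succ m ih =>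
    intro g y hg hy
    by_cases hyr : |y| ≤ (r : ℤ)
    · rw [rademacherTube_sum_succ (r : ℤ) m g y hyr, Fin.prod_univ_succ]
      have hg' : ∀ i : Fin m, g i.succ ≤ r := fun i => hg i.succ
      have hg0 : (g 0 : ℤ) ≤ r := by exact_mod_cast hg 0
      have habs0 : |(g 0 : ℤ)| = g 0 := abs_of_nonneg (by positivity)
      have hy1 : |y + (g 0 : ℤ)| ≤ 2 * (r : ℤ) := by
        have := abs_add_le y (g 0 : ℤ)
        linarith
      have hy2 : |y - (g 0 : ℤ)| ≤ 2 * (r : ℤ) := by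
        have := abs_sub y (g 0 : ℤ)
        linarith
      have h1 := ih (fun i => g i.succ) (y + g 0) hg' hy1
      have h2 := ih (fun i => g i.succ) (y - g 0) hg' hy2
      refine le_trans (add_le_add h1 h2) (le_of_eq ?_)
      push_cast
      rw [mul_add, mul_sub, Real.cos_add, Real.cos_sub]
      ring
    · refine le_trans (le_of_eq (Finset.sum_eq_zero fun σ _ => if_neg fun hall => hyr ?_))
        (rademacherAntiTube_rhs_nonneg r (m + 1) g y hr hg hy)
      simpa using hall 0 (Nat.zero_le _)

/-- `cos x ≤ exp (-x²/4)` for `|x| ≤ 1`: `cos x ≤ 1 - x²/2 + (5/96) x⁴ ≤ 1 - x²/4 ≤ exp (-x²/4)`. -/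
theorem rademacherAntiTube_cos_le_exp {x : ℝ} (h : |x| ≤ 1) :
    Real.cos x ≤ Real.exp (-(x ^ 2 / 4)) := by
  have hb := (abs_le.mp (Real.cos_bound h)).2
  have hx2 : x ^ 2 ≤ 1 := (sq_le_one_iff_abs_le_one x).mpr h
  have hx4 : |x| ^ 4 ≤ x ^ 2 := by
    calc |x| ^ 4 = x ^ 2 * x ^ 2 := by rw [← sq_abs x]; ring
      _ ≤ x ^ 2 * 1 := mul_le_mul_of_nonneg_left hx2 (sq_nonneg x)
      _ = x ^ 2 := mul_one _
  have hexp := Real.add_one_le_exp (-(x ^ 2 / 4))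
  nlinarith [sq_nonneg x]

/-- The numerical constant: `exp (-(5 π² / 64)) ≤ 1/2`, from `π > 3` and `log 2 < 45/64`. -/
theorem rademacherAntiTube_exp_le_half : Real.exp (-(5 * Real.pi ^ 2 / 64)) ≤ 1 / 2 := by
  have hpi : (45 / 64 : ℝ) ≤ 5 * Real.pi ^ 2 / 64 := by nlinarith [Real.pi_gt_three]
  have hlog : Real.log 2 ≤ 5 * Real.pi ^ 2 / 64 := by
    have := Real.log_two_lt_d9
    norm_num at this
    linarith
  have h2 : (2 : ℝ) ≤ Real.exp (5 * Real.pi ^ 2 / 64) := by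
    calc (2 : ℝ) = Real.exp (Real.log 2) := (Real.exp_log (by norm_num)).symm
      _ ≤ _ := Real.exp_le_exp.mpr hlog
  have hE : Real.exp (-(5 * Real.pi ^ 2 / 64)) * Real.exp (5 * Real.pi ^ 2 / 64) = 1 := by
    rw [← Real.exp_add]; simp
  have hE0 : 0 < Real.exp (-(5 * Real.pi ^ 2 / 64)) := Real.exp_pos _
  nlinarith [mul_le_mul_of_nonneg_left h2 hE0.le]

/-- Upper bound for the product of the step factors: `∏ cos(π hᵢ/(4r)) ≤ (1/2)^K` when
`5 K r² ≤ ∑ hᵢ²` (using `cos x ≤ exp(-x²/4)` on `[0, 1]`, `π > 3` and `log 2 < 45/64`). -/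
theorem rademacherAntiTube_prod_cos_le {n : ℕ} (r K : ℕ) (h : Fin n → ℕ) (hr : 1 ≤ r)
    (hh : ∀ i, h i ≤ r) (hK : 5 * K * r ^ 2 ≤ (∑ i, h i ^ 2)) :
    ∏ i : Fin n, Real.cos (Real.pi / (4 * r) * h i) ≤ (1 / 2 : ℝ) ^ K := by
  have hr' : (0 : ℝ) < r := by exact_mod_cast hr
  have hK' : 5 * (K : ℝ) * (r : ℝ) ^ 2 ≤ ∑ i, ((h i : ℝ)) ^ 2 := by exact_mod_cast hK
  have hfac : ∀ i, Real.cos (Real.pi / (4 * r) * h i) ≤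
      Real.exp (-((Real.pi / (4 * r) * h i) ^ 2 / 4)) := fun i => by
    obtain ⟨h0, h1⟩ := rademacherAntiTube_step_angle r (h i) hr (hh i)
    exact rademacherAntiTube_cos_le_exp (by rw [abs_of_nonneg h0]; linarith [Real.pi_le_four])
  calc ∏ i : Fin n, Real.cos (Real.pi / (4 * r) * h i)
      ≤ ∏ i : Fin n, Real.exp (-((Real.pi / (4 * r) * h i) ^ 2 / 4)) :=
        Finset.prod_le_prod (fun i _ => rademacherAntiTube_cos_step_nonneg r (h i) hr (hh i))
          fun i _ => hfac i
    _ = Real.exp (∑ i : Fin n, -((Real.pi / (4 * r) * h i) ^ 2 / 4)) := (Real.exp_sum _ _).symm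
    _ ≤ Real.exp (K * (-(5 * Real.pi ^ 2 / 64))) := by
        rw [Real.exp_le_exp]
        have hsum : ∑ i : Fin n, -((Real.pi / (4 * r) * h i) ^ 2 / 4) =
            -((Real.pi / (4 * r)) ^ 2 / 4 * ∑ i, ((h i : ℝ)) ^ 2) := by
          rw [Finset.mul_sum, ← Finset.sum_neg_distrib]
          refine Finset.sum_congr rfl fun i _ => ?_
          ring
        have ha : (Real.pi / (4 * r)) ^ 2 / 4 * (5 * (K : ℝ) * (r : ℝ) ^ 2) =
            5 * Real.pi ^ 2 / 64 * K := by
          field_simp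
          ring
        have hmono : (Real.pi / (4 * r)) ^ 2 / 4 * (5 * (K : ℝ) * (r : ℝ) ^ 2) ≤
            (Real.pi / (4 * r)) ^ 2 / 4 * ∑ i, ((h i : ℝ)) ^ 2 :=
          mul_le_mul_of_nonneg_left hK' (by positivity)
        rw [hsum]
        linarith
    _ = Real.exp (-(5 * Real.pi ^ 2 / 64)) ^ K := Real.exp_nat_mul _ _
    _ ≤ (1 / 2 : ℝ) ^ K := by
        gcongr
        exact rademacherAntiTube_exp_le_half

/-- **R2, the universal Rademacher anti-tube lemma** (stub `stub_rademacherAntiTube` of the line `Sketch`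
of crux `ConfinementPositivity`): if all steps satisfy `hᵢ ≤ r` (`r ≥ 1`) and `5 K r² ≤ ∑ hᵢ²`, then at
most `2 · 2ⁿ / 2^K` of the `2ⁿ` sign patterns keep every partial sum `∑_{i<k} ±hᵢ` in `[-r, r]`. -/
theorem stub_rademacherAntiTube :
    ∀ (n r K : ℕ) (h : Fin n → ℕ), 1 ≤ r → (∀ i, h i ≤ r) → 5 * K * r ^ 2 ≤ (∑ i, h i ^ 2) →
      2 ^ K * ((Finset.univ : Finset (Fin n → Bool)).filter
          (fun σ => ∀ k ≤ n, |∑ i : Fin n, (if (i : ℕ) < k then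
            (if σ i then (h i : ℤ) else -(h i : ℤ)) else 0)| ≤ (r : ℤ))).card ≤ 2 * 2 ^ n := by
  intro n r K h hr hh hK
  have hclaim := rademacherAntiTube_cos_claim r hr n h 0 hh (by simp)
  simp only [Int.cast_zero, mul_zero, Real.cos_zero, mul_one, zero_add, Finset.sum_boole] at hclaim
  have hprod := rademacherAntiTube_prod_cos_le r K h hr hh hK
  have h2n : (0 : ℝ) ≤ 2 ^ n * 2 := by positivity
  have hfin := hclaim.trans (mul_le_mul_of_nonneg_left hprod h2n)
  have h2K : (0 : ℝ) ≤ 2 ^ K := by positivity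
  have hE : (2 : ℝ) ^ K * (2 ^ n * 2 * (1 / 2 : ℝ) ^ K) = 2 * 2 ^ n := by
    rw [one_div, inv_pow]
    field_simp
  have hreal : (2 : ℝ) ^ K * (((Finset.univ : Finset (Fin n → Bool)).filter
      (fun σ => ∀ k ≤ n, |∑ i : Fin n, (if (i : ℕ) < k then
        (if σ i then (h i : ℤ) else -(h i : ℤ)) else 0)| ≤ (r : ℤ))).card : ℝ) ≤ 2 * 2 ^ n :=
    (mul_le_mul_of_nonneg_left hfin h2K).trans hE.le
  exact_mod_cast hreal

end Summit.CriticalPhenomena.SAWScalingLimit.Theorems
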